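import Summits.AtomisticToContinuum.Crystallization.Theorems.FrustratedLawDichotomyStrainedPatchHomLeafTableFoldP
import Summits.AtomisticToContinuum.Crystallization.Theorems.FrustratedLawDichotomyStrainedPatchHomLeafTableSoundK

/-!
# Param-form leaf — ACCUMULATOR SUMS and treated-label facts for the radius-generic fold (integer layer, part 2)

decomp-a2c hand-1 g23 (crux `AperiodicFrustratedLawGap`, stmt-AtomisticToContinuum-27623; critic row 882).  DEF-FREE.  Verbatim twins, for the
radius-generic fold `foldNLR tab k r` of `…HomLeafTableCheckP`, of hand-1 g20's `rowOf_of_treated` / `incr_fields` / `rowOf_eq_rowT` /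
★ `acc_sums` / `farB_of_untreated` and of g22's `treated_factsK` (table hypothesis `tab.allOK E ∨ tab.allOKK E P`): `rowOf_of_treatedR`,
`incr_fieldsR`, `rowOf_eq_rowTR`, ★ `acc_sumsR`, `farBR_of_untreated`, `treated_factsR`.  (`rowOf`, `rowT`, `dlt`, `q0N` do not involve the radius and
are reused as they are.)  0 sorry; standard axioms.  `--supports stmt-AtomisticToContinuum-27623`.
-/

noncomputable section

namespace Summit.AtomisticToContinuum.Crystallization.Theorems.FrustratedLawDichotomyStrainedPatchHomLeafTableCheck

/-- The row of a treatedR label exists and passes the range test. [formal bookkeeping] -/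
theorem rowOf_of_treatedR {tab : QT} {k : LK} {r : NL → ℕ} {l : NL} (h : treatedR tab k r l = true) :
    Nat.ble (qNeg k l + r l) (qPos k l) = true ∧ farBR k r l = false ∧ ∃ row, rowOf tab k l = some row ∧ rangeBR k r l row = true := by
  unfold treatedR at h
  simp only [Bool.and_eq_true, Bool.not_eq_true'] at h
  obtain ⟨⟨h1, h2⟩, h3⟩ := h
  refine ⟨h1, h2, ?_⟩
  cases hr : rowOf tab k l with
  | none => rw [hr] at h3; exact Bool.noConfusion h3
  | some row => rw [hr] at h3; exact ⟨row, rfl, h3⟩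

/-- The increment of a treatedR label with row `row`: its signed fields. [formal bookkeeping] -/
theorem incr_fieldsR {tab : QT} {k : LK} {r : NL → ℕ} {l : NL} {row : Row} (h : treatedR tab k r l = true) (hr : rowOf tab k l = some row) :
    (incrR tab k r l).ok = true ∧
    (((incrR tab k r l).vP : ℕ) : ℤ) - (incrR tab k r l).vN = sgnZ row.sV row.aV ∧
    (((incrR tab k r l).dP : ℕ) : ℤ) - (incrR tab k r l).dN = sgnZ row.sD row.aD * ((q0N k l - row.t : ℕ) : ℤ) ∧
    (incrR tab k r l).sd = q0N k l - row.t ∧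
    (((incrR tab k r l).g0P : ℕ) : ℤ) - (incrR tab k r l).g0N = sgnZ row.sD row.aD * (l.m00 : ℤ) ∧
    (((incrR tab k r l).g1P : ℕ) : ℤ) - (incrR tab k r l).g1N = sgnZ row.sD row.aD * (l.m11 : ℤ) ∧
    (((incrR tab k r l).g2P : ℕ) : ℤ) - (incrR tab k r l).g2N = sgnZ row.sD row.aD * (l.m22 : ℤ) ∧
    (((incrR tab k r l).g3P : ℕ) : ℤ) - (incrR tab k r l).g3N = sgnZ row.sD row.aD * sgnZ l.s01 l.m01 ∧
    (((incrR tab k r l).g4P : ℕ) : ℤ) - (incrR tab k r l).g4N = sgnZ row.sD row.aD * sgnZ l.s02 l.m02 ∧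
    (((incrR tab k r l).g5P : ℕ) : ℤ) - (incrR tab k r l).g5N = sgnZ row.sD row.aD * sgnZ l.s12 l.m12 ∧
    (incrR tab k r l).cur = row.M * ((q0N k l - row.t + r l) * (q0N k l - row.t + r l)) := by
  unfold incrR
  rw [h, hr]
  dsimp only [step4, acc0]
  refine ⟨rfl, ?_, ?_, ?_, ?_, ?_, ?_, ?_, ?_, ?_, ?_⟩ <;> (try simp only [Nat.add_eq, Nat.mul_eq, Nat.zero_add])
  · exact addP_sub_addN _ _
  · rw [addP_sub_addN, sgnZ_mul]
  · rw [addP_sub_addN, sgnZ_mul]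
  · rw [addP_sub_addN, sgnZ_mul]
  · rw [addP_sub_addN, sgnZ_mul]
  · rw [addP_sub_addN, sgnZ_sx]
  · rw [addP_sub_addN, sgnZ_sx]
  · rw [addP_sub_addN, sgnZ_sx]

/-- For a treatedR record the row used is the row found. [formal bookkeeping] -/
theorem rowOf_eq_rowTR {tab : QT} {k : LK} {r : NL → ℕ} {l : NL} (h : treatedR tab k r l = true) : rowOf tab k l = some (rowT tab k l) := by
  obtain ⟨-, -, row, hr, -⟩ := rowOf_of_treatedR h
  unfold rowT; rw [hr]

/-- ★ **THE ACCUMULATOR SUMS.**  For a passing fold, with `T` = the treatedR visited records: every visited record passes its step, and the signed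
accumulator fields are the sums over `T` of the per-record data read from the rows used. [formal bookkeeping] -/
theorem acc_sumsR {tab : QT} {k : LK} {r : NL → ℕ} {nstop : ℕ} {labs : List NL} (hok : (foldNLR tab k r nstop acc0 labs).ok = true) :
    (∀ l ∈ visited nstop labs, stepOKR tab k r l = true) ∧
    (((foldNLR tab k r nstop acc0 labs).vP : ℤ) - (foldNLR tab k r nstop acc0 labs).vN =
      (((visited nstop labs).filter (fun l => treatedR tab k r l)).map (fun l => sgnZ (rowT tab k l).sV (rowT tab k l).aV)).sum) ∧
    (((foldNLR tab k r nstop acc0 labs).dP : ℤ) - (foldNLR tab k r nstop acc0 labs).dN =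
      (((visited nstop labs).filter (fun l => treatedR tab k r l)).map
        (fun l => sgnZ (rowT tab k l).sD (rowT tab k l).aD * (dlt tab k l : ℤ))).sum) ∧
    ((foldNLR tab k r nstop acc0 labs).sd = (((visited nstop labs).filter (fun l => treatedR tab k r l)).map (fun l => dlt tab k l)).sum) ∧
    (((foldNLR tab k r nstop acc0 labs).g0P : ℤ) - (foldNLR tab k r nstop acc0 labs).g0N =
      (((visited nstop labs).filter (fun l => treatedR tab k r l)).map (fun l => sgnZ (rowT tab k l).sD (rowT tab k l).aD * (l.m00 : ℤ))).sum) ∧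
    (((foldNLR tab k r nstop acc0 labs).g1P : ℤ) - (foldNLR tab k r nstop acc0 labs).g1N =
      (((visited nstop labs).filter (fun l => treatedR tab k r l)).map (fun l => sgnZ (rowT tab k l).sD (rowT tab k l).aD * (l.m11 : ℤ))).sum) ∧
    (((foldNLR tab k r nstop acc0 labs).g2P : ℤ) - (foldNLR tab k r nstop acc0 labs).g2N =
      (((visited nstop labs).filter (fun l => treatedR tab k r l)).map (fun l => sgnZ (rowT tab k l).sD (rowT tab k l).aD * (l.m22 : ℤ))).sum) ∧
    (((foldNLR tab k r nstop acc0 labs).g3P : ℤ) - (foldNLR tab k r nstop acc0 labs).g3N =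
      (((visited nstop labs).filter (fun l => treatedR tab k r l)).map
        (fun l => sgnZ (rowT tab k l).sD (rowT tab k l).aD * sgnZ l.s01 l.m01)).sum) ∧
    (((foldNLR tab k r nstop acc0 labs).g4P : ℤ) - (foldNLR tab k r nstop acc0 labs).g4N =
      (((visited nstop labs).filter (fun l => treatedR tab k r l)).map
        (fun l => sgnZ (rowT tab k l).sD (rowT tab k l).aD * sgnZ l.s02 l.m02)).sum) ∧
    (((foldNLR tab k r nstop acc0 labs).g5P : ℤ) - (foldNLR tab k r nstop acc0 labs).g5N =
      (((visited nstop labs).filter (fun l => treatedR tab k r l)).map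
        (fun l => sgnZ (rowT tab k l).sD (rowT tab k l).aD * sgnZ l.s12 l.m12)).sum) ∧
    ((foldNLR tab k r nstop acc0 labs).cur = (((visited nstop labs).filter (fun l => treatedR tab k r l)).map
        (fun l => (rowT tab k l).M * ((dlt tab k l + r l) * (dlt tab k l + r l)))).sum) := by
  rw [foldNLR_eq] at hok ⊢
  obtain ⟨-, hall, heq⟩ := foldl_stepR_eq tab k r (visited nstop labs) acc0 hok
  rw [heq]
  set T := (visited nstop labs).filter (fun l => treatedR tab k r l) with hT
  have hTt : ∀ l ∈ T, treatedR tab k r l = true := fun l hl => (List.mem_filter.1 hl).2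
  -- per-record field identities on T
  have hF : ∀ l ∈ T, (incrR tab k r l).ok = true ∧
      (((incrR tab k r l).vP : ℕ) : ℤ) - (incrR tab k r l).vN = sgnZ (rowT tab k l).sV (rowT tab k l).aV ∧
      (((incrR tab k r l).dP : ℕ) : ℤ) - (incrR tab k r l).dN = sgnZ (rowT tab k l).sD (rowT tab k l).aD * ((dlt tab k l : ℕ) : ℤ) ∧
      (incrR tab k r l).sd = dlt tab k l ∧
      (((incrR tab k r l).g0P : ℕ) : ℤ) - (incrR tab k r l).g0N = sgnZ (rowT tab k l).sD (rowT tab k l).aD * (l.m00 : ℤ) ∧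
      (((incrR tab k r l).g1P : ℕ) : ℤ) - (incrR tab k r l).g1N = sgnZ (rowT tab k l).sD (rowT tab k l).aD * (l.m11 : ℤ) ∧
      (((incrR tab k r l).g2P : ℕ) : ℤ) - (incrR tab k r l).g2N = sgnZ (rowT tab k l).sD (rowT tab k l).aD * (l.m22 : ℤ) ∧
      (((incrR tab k r l).g3P : ℕ) : ℤ) - (incrR tab k r l).g3N = sgnZ (rowT tab k l).sD (rowT tab k l).aD * sgnZ l.s01 l.m01 ∧
      (((incrR tab k r l).g4P : ℕ) : ℤ) - (incrR tab k r l).g4N = sgnZ (rowT tab k l).sD (rowT tab k l).aD * sgnZ l.s02 l.m02 ∧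
      (((incrR tab k r l).g5P : ℕ) : ℤ) - (incrR tab k r l).g5N = sgnZ (rowT tab k l).sD (rowT tab k l).aD * sgnZ l.s12 l.m12 ∧
      (incrR tab k r l).cur = (rowT tab k l).M * ((dlt tab k l + r l) * (dlt tab k l + r l)) :=
    fun l hl => incr_fieldsR (hTt l hl) (rowOf_eq_rowTR (hTt l hl))
  have e0 : ∀ (P N : Acc → ℕ), (∀ a c, P (a.add c) = P a + P c) → (∀ a c, N (a.add c) = N a + N c) → P acc0 = 0 → N acc0 = 0 →
      ∀ (hfn : NL → ℤ), (∀ l ∈ T, ((P (incrR tab k r l) : ℕ) : ℤ) - ((N (incrR tab k r l) : ℕ) : ℤ) = hfn l) →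
      ((P (T.foldl (fun acc l => acc.add (incrR tab k r l)) acc0) : ℕ) : ℤ) - ((N (T.foldl (fun acc l => acc.add (incrR tab k r l)) acc0) : ℕ) : ℤ) =
        ((T.map hfn).sum : ℤ) := by
    intro P N hP hN hP0 hN0 hfn hh
    rw [proj_sub_foldl_add P N hP hN (incrR tab k r) T acc0, hP0, hN0]
    have := cast_sum_sub_eq (fun l => P (incrR tab k r l)) (fun l => N (incrR tab k r l)) hfn T hh
    simp only [Nat.cast_zero, sub_zero, zero_add]
    rw [← this]
  have e1 : ∀ (P : Acc → ℕ), (∀ a c, P (a.add c) = P a + P c) → P acc0 = 0 → ∀ (hfn : NL → ℕ), (∀ l ∈ T, P (incrR tab k r l) = hfn l) →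
      P (T.foldl (fun acc l => acc.add (incrR tab k r l)) acc0) = ((T.map hfn).sum : ℕ) := by
    intro P hP hP0 hfn hh
    rw [proj_foldl_add P hP (incrR tab k r) T acc0, hP0, Nat.zero_add]
    exact congrArg List.sum (List.map_congr_left hh)
  refine ⟨hall, ?_, ?_, ?_, ?_, ?_, ?_, ?_, ?_, ?_, ?_⟩
  · exact e0 Acc.vP Acc.vN (fun _ _ => rfl) (fun _ _ => rfl) rfl rfl _ (fun l hl => (hF l hl).2.1)
  · exact e0 Acc.dP Acc.dN (fun _ _ => rfl) (fun _ _ => rfl) rfl rfl _ (fun l hl => (hF l hl).2.2.1)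
  · exact e1 Acc.sd (fun _ _ => rfl) rfl _ (fun l hl => (hF l hl).2.2.2.1)
  · exact e0 Acc.g0P Acc.g0N (fun _ _ => rfl) (fun _ _ => rfl) rfl rfl _ (fun l hl => (hF l hl).2.2.2.2.1)
  · exact e0 Acc.g1P Acc.g1N (fun _ _ => rfl) (fun _ _ => rfl) rfl rfl _ (fun l hl => (hF l hl).2.2.2.2.2.1)
  · exact e0 Acc.g2P Acc.g2N (fun _ _ => rfl) (fun _ _ => rfl) rfl rfl _ (fun l hl => (hF l hl).2.2.2.2.2.2.1)
  · exact e0 Acc.g3P Acc.g3N (fun _ _ => rfl) (fun _ _ => rfl) rfl rfl _ (fun l hl => (hF l hl).2.2.2.2.2.2.2.1)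
  · exact e0 Acc.g4P Acc.g4N (fun _ _ => rfl) (fun _ _ => rfl) rfl rfl _ (fun l hl => (hF l hl).2.2.2.2.2.2.2.2.1)
  · exact e0 Acc.g5P Acc.g5N (fun _ _ => rfl) (fun _ _ => rfl) rfl rfl _ (fun l hl => (hF l hl).2.2.2.2.2.2.2.2.2.1)
  · exact e1 Acc.cur (fun _ _ => rfl) rfl _ (fun l hl => (hF l hl).2.2.2.2.2.2.2.2.2.2)

/-- A passing untreated label is far: `farBR = true`, with `rad ≤ q0N` and `qNeg ≤ qPos`. [formal bookkeeping] -/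
theorem farBR_of_untreated {tab : QT} {k : LK} {r : NL → ℕ} {l : NL} (hs : stepOKR tab k r l = true) (ht : treatedR tab k r l = false) :
    qNeg k l + r l ≤ qPos k l ∧ farBR k r l = true := by
  unfold stepOKR at hs; unfold treatedR at ht
  simp only [Bool.and_eq_true, Nat.ble_eq, Bool.or_eq_true] at hs
  obtain ⟨h1, h2⟩ := hs
  refine ⟨h1, ?_⟩
  cases hf : farBR k r l
  · rw [hf] at ht h2
    simp only [Nat.ble_eq_true_of_le h1, Bool.not_false, Bool.true_and, Bool.false_eq_true, false_or] at ht h2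
    rw [h2] at ht; exact absurd ht (by simp)
  · rfl

/-- A treatedR label's arithmetic facts: `qNeg + rad ≤ qPos`, the range test of its row, and the row is certified. (v2- or v3-certified table) [formal bookkeeping] -/
theorem treated_factsR {tab : QT} {E P : ℕ} (htab : tab.allOK E = true ∨ tab.allOKK E P = true) {k : LK} {r : NL → ℕ} {l : NL} (ht : treatedR tab k r l = true) :
    qNeg k l + r l ≤ qPos k l ∧ (rowT tab k l).A ≤ q0N k l - r l ∧ q0N k l + r l ≤ (rowT tab k l).B ∧
      (rowT tab k l).t ≤ q0N k l ∧ ((rowT tab k l).ok E = true ∨ (rowT tab k l).okK E P = true) := by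
  obtain ⟨h1, -, row, hr, hrange⟩ := rowOf_of_treatedR ht
  have hrow : rowT tab k l = row := by unfold rowT; rw [hr]
  rw [hrow]
  unfold rangeBR at hrange
  simp only [Bool.and_eq_true, Nat.ble_eq] at hrange
  exact ⟨Nat.le_of_ble_eq_true h1, hrange.1.1, hrange.1.2, hrange.2,
    htab.elim (fun h => Or.inl (QT.findLE_none_ok h hr)) (fun h => Or.inr (QT.findLE_none_okK h hr))⟩

end Summit.AtomisticToContinuum.Crystallization.Theorems.FrustratedLawDichotomyStrainedPatchHomLeafTableCheck

end
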